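import Mathlib
import Summits.QuantumAdvantage.QuantumAdvantage.Theorems.MobiusLadderQuadraticDigitPhasesStubCondCount

/-!
# Conditional window counting with private cores (stub `stub_condCountR`)

The stub `stub_condCountR` of the crux `MobiusLadder.QuadraticDigitPhases`
(stmt-QuantumAdvantage-1391), line `Sketch`.  Mathlib plus the helpers of the sibling stub
`stub_condCount` (`window_count`, `digit_decomp`, `sub_window`, `sub_window_add`,
`add_mul_mod_of_dvd`); no number theory.

Setting: `d` Boolean events `F j` on inputs `T < 2^N`; `F j` depends only on the bits of `T` at
positions `≤ top j` together with the bits at the positions of a private set `Rj j`; the tops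
increase with gaps `> k`; no window `[top j - k, top j]` contains a position of any `Rj i`; and for
every input, re-setting the window of `k + 1` bits `[top j - k, top j]` in all `2^(k+1)` ways
satisfies `F j` at most `(1 - c) 2^(k+1)` times.  Conclusion: at most `(1 - c)^d 2^N` inputs satisfy
all `F j`.

Proof: induction on `d`, peeling off the last (highest) event, exactly as for `stub_condCount`; the
only new point is that the earlier events are constant on each window group because they see only
bits below the window (positions `≤ top i < top last - k`) and bits of `Rj i`, which lie either
more than `k` below `top last` or strictly above it, hence outside the window
(`testBit_sub_window`).  Since these events are no longer periodic in the window base, the sibling's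
`window_count` is first upgraded to `window_count'`, whose invariance hypothesis is only invariance
under zeroing the window digit: slice the range by the high digit and apply `window_count` with one
slice (`window_count_one`).
-/

set_option linter.dupNamespace false -- D-0017: single-problem summit ⇒ `QuantumAdvantage.QuantumAdvantage` by design

namespace Summit.QuantumAdvantage.QuantumAdvantage.Theorems.MobiusLadderQuadraticDigitPhasesStubCondCountR

open Finset
open Summit.QuantumAdvantage.QuantumAdvantage.Theorems.MobiusLadderQuadraticDigitPhasesStubCondCount

/-- Changing the middle digit `w < 2^m` of `2^a (2^m hi + w) + lo` does not change the bits at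
positions `< a` or `≥ a + m`. -/
theorem testBit_window_indep (a m hi lo w w' x : ℕ) (hlo : lo < 2 ^ a) (hw : w < 2 ^ m)
    (hw' : w' < 2 ^ m) (hx : x < a ∨ a + m ≤ x) :
    Nat.testBit (2 ^ a * (2 ^ m * hi + w) + lo) x =
      Nat.testBit (2 ^ a * (2 ^ m * hi + w') + lo) x := by
  rw [Nat.testBit_two_pow_mul_add _ hlo, Nat.testBit_two_pow_mul_add _ hlo]
  split_ifs with h
  · rfl
  · rw [Nat.testBit_two_pow_mul_add _ hw, Nat.testBit_two_pow_mul_add _ hw', if_neg (by omega),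
      if_neg (by omega)]

/-- Zeroing the window digit `T / 2^a mod 2^m` of `T` does not change the bits at positions `< a`
or `≥ a + m`. -/
theorem testBit_sub_window (T a m x : ℕ) (hx : x < a ∨ a + m ≤ x) :
    Nat.testBit (T - T / 2 ^ a % 2 ^ m * 2 ^ a) x = Nat.testBit T x := by
  have hlo : T % 2 ^ a < 2 ^ a := Nat.mod_lt _ (by positivity)
  have hM : 0 < 2 ^ m := by positivity
  have hw : T / 2 ^ a % 2 ^ m < 2 ^ m := Nat.mod_lt _ hM
  have e1 : T - T / 2 ^ a % 2 ^ m * 2 ^ a =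
      2 ^ a * (2 ^ m * (T / 2 ^ a / 2 ^ m) + 0) + T % 2 ^ a := by
    rw [sub_window]
    ring
  have e2 : 2 ^ a * (2 ^ m * (T / 2 ^ a / 2 ^ m) + T / 2 ^ a % 2 ^ m) + T % 2 ^ a = T := by
    rw [Nat.div_add_mod, Nat.div_add_mod]
  rw [e1, testBit_window_indep a m _ _ 0 (T / 2 ^ a % 2 ^ m) x hlo hM hw hx, e2]

/-- Counting over `range (a + b)` splits into `range a` and a shifted `range b`. -/
theorem card_filter_range_add (a b : ℕ) (R : ℕ → Prop) [DecidablePred R] :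
    ((range (a + b)).filter R).card =
      ((range a).filter R).card + ((range b).filter (fun T => R (a + T))).card := by
  rw [range_add, filter_union,
    card_union_of_disjoint (disjoint_filter_filter (disjoint_range_addLeftEmbedding a _)),
    filter_map, card_map]
  rfl

/-- `window_count` with a single high slice (`H = 1`) and the invariance of `P` only required
under zeroing the window digit of inputs below `M·B`. -/
theorem window_count_one (B M : ℕ) (hB : 0 < B) (hM : 0 < M) (c : ℝ) (P Q : ℕ → Prop)
    [DecidablePred P] [DecidablePred Q] (hP : ∀ T < M * B, P T ↔ P (T % B))
    (hQ : ∀ T, (((range M).filter (fun w => Q (T - T / B % M * B + w * B))).card : ℝ) ≤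
      (1 - c) * M) :
    (((range (M * B)).filter (fun T => P T ∧ Q T)).card : ℝ) ≤
      (1 - c) * ((range (M * B)).filter P).card := by
  have h := window_count B M 1 hB hM c (fun T => P (T % B)) Q
    (fun Z w => by simp only [Nat.add_mul_mod_self_right]) hQ
  rw [one_mul] at h
  have e1 : (range (M * B)).filter (fun T => P T ∧ Q T) =
      (range (M * B)).filter (fun T => P (T % B) ∧ Q T) :=
    filter_congr fun T hT => by rw [hP T (mem_range.1 hT)]
  have e2 : (range (M * B)).filter P = (range (M * B)).filter (fun T => P (T % B)) :=
    filter_congr fun T hT => hP T (mem_range.1 hT)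
  rw [e1, e2]
  exact h

/-- **Window counting, non-periodic version.**  As `window_count`, but `P` is only required to be
invariant under zeroing the window digit `w = T/B mod M` (so `P` may also depend on the digits
above the window). -/
theorem window_count' (B M H : ℕ) (hB : 0 < B) (hM : 0 < M) (c : ℝ) (P Q : ℕ → Prop)
    [DecidablePred P] [DecidablePred Q] (hP : ∀ T, P (T - T / B % M * B) ↔ P T)
    (hQ : ∀ T, (((range M).filter (fun w => Q (T - T / B % M * B + w * B))).card : ℝ) ≤
      (1 - c) * M) :
    (((range (H * M * B)).filter (fun T => P T ∧ Q T)).card : ℝ) ≤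
      (1 - c) * ((range (H * M * B)).filter P).card := by
  induction H with
  | zero => simp
  | succ H ih =>
    rw [show (H + 1) * M * B = H * M * B + M * B by ring, card_filter_range_add,
      card_filter_range_add _ _ P, Nat.cast_add, Nat.cast_add, mul_add]
    refine add_le_add ih (window_count_one B M hB hM c (fun T => P (H * M * B + T))
      (fun T => Q (H * M * B + T)) (fun T hT => ?_) (fun T => ?_))
    · have hdm : (H * M * B + T) / B % M = T / B % M := by
        rw [add_comm, Nat.add_mul_div_right _ _ hB, Nat.add_mul_mod_self_right]
      have hdiv : T / B < M := (Nat.div_lt_iff_lt_mul hB).2 hT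
      have hmod : T / B % M = T / B := Nat.mod_eq_of_lt hdiv
      have hT' : T - T / B * B = T % B := by
        have := Nat.div_add_mod T B
        rw [Nat.mul_comm] at this
        omega
      have hle : T / B * B ≤ T := Nat.div_mul_le_self T B
      have := hP (H * M * B + T)
      rw [hdm, hmod, Nat.add_sub_assoc hle, hT'] at this
      exact this.symm
    · have hdm : (H * M * B + T) / B % M = T / B % M := by
        rw [add_comm, Nat.add_mul_div_right _ _ hB, Nat.add_mul_mod_self_right]
      have hle : T / B % M * B ≤ T := by
        have := digit_decomp T B M
        omega
      have h := hQ (H * M * B + T)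
      rw [hdm] at h
      have e : (range M).filter (fun w => Q (H * M * B + (T - T / B % M * B + w * B))) =
          (range M).filter (fun w => Q (H * M * B + T - T / B % M * B + w * B)) :=
        filter_congr fun w _ => by
          rw [show H * M * B + (T - T / B % M * B + w * B) = H * M * B + T - T / B % M * B + w * B
            by omega]
      rw [e]
      exact h

/-- **Conditional window counting with private cores.**  `d` Boolean events `F j` on inputs
`T < 2^N`, `F j` depending only on the bits at positions `≤ top j` and at the positions in `Rj j`,
tops increasing with gaps `> k`, every position in any `Rj i` more than `k` below or strictly above
every top, and for every input at most a `(1 - c)`-fraction of the `2^(k+1)` re-settings of the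
window bits `[top j - k, top j]` satisfying `F j`: then at most `(1 - c)^d 2^N` inputs satisfy every
`F j`. -/
theorem stub_condCountR :
    ∀ (N d k : ℕ) (c : ℝ) (top : Fin d → ℕ) (Rj : Fin d → Finset ℕ) (F : Fin d → ℕ → Bool),
      (∀ j, k ≤ top j ∧ top j < N) → (∀ i j : Fin d, i < j → top i + k < top j) →
      (∀ i j : Fin d, ∀ x ∈ Rj i, x + k < top j ∨ top j < x) →
      (∀ j, ∀ T T' : ℕ, T % 2 ^ (top j + 1) = T' % 2 ^ (top j + 1) →
          (∀ x ∈ Rj j, Nat.testBit T x = Nat.testBit T' x) → F j T = F j T') →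
      (∀ j, ∀ T : ℕ, (((Finset.range (2 ^ (k + 1))).filter (fun w =>
          F j (T - (T / 2 ^ (top j - k) % 2 ^ (k + 1)) * 2 ^ (top j - k) + w * 2 ^ (top j - k)) = true)).card : ℝ) ≤
          (1 - c) * (2 : ℝ) ^ (k + 1)) →
      (((Finset.range (2 ^ N)).filter (fun T => ∀ j, F j T = true)).card : ℝ) ≤ (1 - c) ^ d * (2 : ℝ) ^ N := by
  intro N d k c
  induction d with
  | zero =>
    intro top Rj F _ _ _ _ _
    rw [pow_zero, one_mul]
    calc (((range (2 ^ N)).filter (fun T => ∀ j, F j T = true)).card : ℝ)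
        ≤ ((range (2 ^ N)).card : ℝ) := by exact_mod_cast card_filter_le _ _
      _ = 2 ^ N := by rw [card_range, Nat.cast_pow, Nat.cast_ofNat]
  | succ d ih =>
    intro top Rj F h1 h2 hR h3 h4
    obtain ⟨hk, hN⟩ := h1 (Fin.last d)
    have hc : 0 ≤ 1 - c :=
      nonneg_of_mul_nonneg_left ((Nat.cast_nonneg _).trans (h4 (Fin.last d) 0)) (by positivity)
    have ih' := ih (fun i => top i.castSucc) (fun i => Rj i.castSucc) (fun i => F i.castSucc)
      (fun j => h1 _) (fun i j hij => h2 _ _ (Fin.castSucc_lt_castSucc_iff.2 hij))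
      (fun i j => hR _ _) (fun j => h3 _) (fun j => h4 _)
    have hB : 0 < 2 ^ (top (Fin.last d) - k) := by positivity
    have hM : 0 < 2 ^ (k + 1) := by positivity
    have hpow : 2 ^ (N - (top (Fin.last d) + 1)) * 2 ^ (k + 1) * 2 ^ (top (Fin.last d) - k) =
        2 ^ N := by
      rw [← pow_add, ← pow_add]
      congr 1
      omega
    have key : (((range (2 ^ N)).filter (fun T => (∀ i : Fin d, F i.castSucc T = true) ∧
        F (Fin.last d) T = true)).card : ℝ) ≤ (1 - c) *
          ((range (2 ^ N)).filter (fun T => ∀ i : Fin d, F i.castSucc T = true)).card := by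
      rw [← hpow]
      refine window_count' (2 ^ (top (Fin.last d) - k)) (2 ^ (k + 1))
        (2 ^ (N - (top (Fin.last d) + 1))) hB hM c (fun T => ∀ i : Fin d, F i.castSucc T = true)
        (fun T => F (Fin.last d) T = true) (fun T => forall_congr' fun i => ?_) (fun T => ?_)
      · have hi : top i.castSucc + k < top (Fin.last d) :=
          h2 i.castSucc (Fin.last d) (Fin.castSucc_lt_last i)
        have hdvd : 2 ^ (top i.castSucc + 1) ∣ 2 ^ (top (Fin.last d) - k) :=
          Nat.pow_dvd_pow 2 (by omega)
        rw [h3 i.castSucc _ T ?_ (fun x hx => testBit_sub_window T _ _ x ?_)]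
        · have e := add_mul_mod_of_dvd (T - T / 2 ^ (top (Fin.last d) - k) % 2 ^ (k + 1) *
            2 ^ (top (Fin.last d) - k)) (T / 2 ^ (top (Fin.last d) - k) % 2 ^ (k + 1)) _ _ hdvd
          rw [sub_window_add] at e
          exact e.symm
        · have := hR i.castSucc (Fin.last d) x hx
          omega
      · have := h4 (Fin.last d) T
        rw [Nat.cast_pow, Nat.cast_ofNat]
        exact this
    have hfilter : (range (2 ^ N)).filter (fun T => ∀ j, F j T = true) =
        (range (2 ^ N)).filter (fun T => (∀ i : Fin d, F i.castSucc T = true) ∧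
          F (Fin.last d) T = true) :=
      filter_congr (fun T _ => Fin.forall_fin_succ')
    rw [hfilter]
    calc _ ≤ _ := key
      _ ≤ (1 - c) * ((1 - c) ^ d * 2 ^ N) := mul_le_mul_of_nonneg_left ih' hc
      _ = (1 - c) ^ (d + 1) * 2 ^ N := by ring

end Summit.QuantumAdvantage.QuantumAdvantage.Theorems.MobiusLadderQuadraticDigitPhasesStubCondCountR
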